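import Literature.MathematicalPhysics.QuantumFieldTheory.BalabanImbrieJaffe1984to88.BIJ88ConnectedGraphResummation
import Literature.MathematicalPhysics.QuantumFieldTheory.BalabanImbrieJaffe1984to88.BIJ88W6PrimeBound
import Literature.MathematicalPhysics.QuantumFieldTheory.BalabanImbrieJaffe1984to88.BIJ88Sect5StatementsPart4

/-!
# `BalabanImbrieJaffe1984to88.BIJ88RemainderW6Prime` — T. Bałaban, J. Imbrie, A. Jaffe, *Effective action and cluster
properties of the abelian Higgs model*, Commun. Math. Phys. **114** (1988) 257–315 [BalabanImbrieJaffe1988]: Sect. 5.14, p. 310 —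
the fourth display **`ℛ_k(Λ₁₂^{(k)}) = Σ_{X ⊂ Λ₁₂^{(k)}} W₆^{(k)′}(X)`** DERIVED from the connected-graph resummation (displays 1–3,
`BIJ88ConnectedGraphResummation`) and LINKED to the model of `W₆^{(k)′}` of `BIJ88W6PrimeBound` (gen 5: `term`, `trunc`, `W6'`) and to
the printed remainder `remR` of (5.14.2) (`BIJ88Sect5StatementsPart4`); with the *"standard exercise"* — absolute convergence of the
connected series of every sub-collection of derivatives under (5.14.4) — done.

HONEST FRAMING (cell `lit-balaban`, verbatim): statement-level skeleton of published theorems with citation tags; proofs where landed; nothing here is a claim about the Yang–Mills mass gap.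

PDF held: `paper:balaban1988-cmp114-bij-abelian-higgs-effective-action` (journal page = PDF page + 256); p. 310 = PDF p. 54 (render
`original-p054-x2.png`, seat folder `renders/`), p. 308 (5.14.2) and p. 309 (5.14.3)–(5.14.4) = PDF pp. 52–53 (materialised text
`p0052.txt`, `p0053.txt`; render `original-p053-x2.png`).

CITATION HEADER (verbatim).  p. 308 [PDF 52], (5.14.2): *"and a remainder ℛ_k(Λ₁₂^{(k)}) = ∫₀¹ dt −((1−t)^{n̄}/(n̄+1)!) ⟨d/dt; …;
d/dt⟩_t. (5.14.2) Here ⟨·⟩_t is the interacting expectation …"*.  p. 310 [PDF 54], after the third display (*"where G_c runs over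
connected graphs involving all clusters X_γ, Y_δ, and hence all of H."*): *"We use this to give an expansion for the remainder from the
perturbation expansion of the interaction: ℛ_k(Λ₁₂^{(k)}) = Σ_{X⊂Λ₁₂^{(k)}} W₆^{(k)′}(X). Here W₆^{(k)′}(X) is obtained by summing only
over {X_γ}, (Y₁, …, Y_B) which fill X, summing over {γ_j} with suppt(d/dt)_{γ_j} ⊂ X, and integrating over t as in (5.14.2). It is
now a standard exercise to estimate the expansion, using (5.14.4)."*  p. 309 [PDF 53], (5.14.4): *"|g₃(H_β, X_β)| ≤
e^{β(L^kε/ε₀)^{1/4−α}(|H_β| + β′|X_β∖H_β|)}. We use X_β∖H_β to denote the set of cubes with no (d/dt)_{γ_j} factors, j ∈ H_β."*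

WHAT IS REPRODUCED (unit `lit-balaban-p25`, generation 6 of the Phase-2 proof seat p25; SKELETON row `C2.Claim@310`, first clause,
file 3/3; HOME `run/shared/lean/pub/lit-balaban/lit-balaban-p25/`).  Setting of gen 5 (`BIJ88W6PrimeBound` §1): cubes `V` (finite),
adjacency `R`, polymers `polys R X` (nonempty `R`-connected `Y ⊆ X`), `n̄+1` derivative slots `H = Fin (n̄+1)`, targets `T` with cube
`loc : T → V`, admissible targets `Γ`, assignments `γ : H → T` (`assignments n̄ Γ loc X` = those with all cubes in `X`), activity
`g₃ : t ↦ γ ↦ (K, Y) ↦ g₃ᵗ(γ; H_β = K, X_β = Y)`.  The resummation file (2/3) is instantiated with slot set `S = H`, localization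
`loc ∘ γ`, polymer family `Q = polys R Λ` (`Λ` = the region `Λ₁₂^{(k)}`) and activity `w = g₃ᵗ(γ,·,·)`.
§1 LINK, degree-wise (`Tord_succ_eq_sum_term`): the connected term of display 3 with `n+1` clusters equals `Σ_{X⊆Λ} term t γ X n` —
  the two ordered bookkeepings agree (`sum_labellings_eq_sum_owp`: labellings `f : H → slots` ↔ ordered weak partitions
  `(f⁻¹(i))_i`, a bijection), admissibility = filling ∧ covering (`sum_ite_adm`), and the tuples of polymers of `Λ` are the
  tuples of polymers of the region `X ⊆ Λ` they fill (`sum_tuples_eq_sum_fillings`: *"summing only over {X_γ}, (Y₁,…,Y_B) which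
  fill X"*).
§2 LINK, summed (`Tsum_univ_eq_sum_trunc`): `T(H) = Σ_{X⊆Λ} trunc t γ X` (the `m = 0` term vanishes, `Tord_zero`).
§3 LOCALIZATION (`trunc_eq_zero_of_not_mem`, `sum_assignments_swap`): `trunc t γ X = 0` unless every derivative cube lies in `X`,
  so `Σ_{γ: supports ⊂ Λ} Σ_{X⊆Λ} = Σ_{X⊆Λ} Σ_{γ: supports ⊂ X}` (*"summing over {γ_j} with suppt(d/dt)_{γ_j} ⊂ X"*).
§4 THE REMAINDER (`remR_eq_sum_W6'`, `remR_eq_sum_W6'_of_display2`): `remR (t ↦ Σ_γ κ_t(γ,H)) n̄ = Σ_{X⊆Λ} W6' X` — from §2–§3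
  and `display3` of file 2/3, exchanging the finite region sum with the `t`-integral (*"integrating over t as in (5.14.2)"*).
§5 THE *"STANDARD EXERCISE"* FOR SUB-COLLECTIONS (`card_owp_cov_le`, `abs_Traw_le`, `sum_abs_Tord_le`, `summable_norm_Tord`): under
  (5.14.4) and gen 5's smallness `16(Δ+1)²θ^{β′/2}e² ≤ 1`, the connected series `Σ_m Tord_m(b)` of EVERY nonempty `b ⊆ H` converges
  absolutely (the hypothesis `hT` of `display3`): steps (a)–(c) as in gen 5 but for a sub-collection (`|g₃(H_i,Z_i)| ≤
  θ^{(1−β′)|H_i|+β′|Z_i|}`, `Σ_i|H_i| = |b|`, the labelled structures number `≤ |b|!·e^{Σ|Z_i|}` by the injective carrier map), step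
  (d) = gen 5's `partialSum_le` (Penrose tree-graph inequality + tuple summation, engine [Dimock2013] App. B).
§6 AS PRINTED IN THE REGIME (5.14.4) (`remR_eq_sum_W6'_of_ineq5144`): all analytic hypotheses of §4 except `z_t ≠ 0` and the
  existence of the `t`-integrals discharged (gen 5's `summable_abs_term` for the region series, §5 for `hT`).
HYPOTHESES, all explicit: `z_t = N(∅) ≠ 0` (the normalization of display 1 is divided by); the truncated expectations `κ_t(γ,K)`,
`∅ ≠ K ⊆ H`, satisfy display 2 against the normalized expectations `N(K)/z_t` (READING (c) of file 2/3: this is their definition);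
`IntervalIntegrable` on `[0,1]` of `t ↦ Σ_{γ: supports ⊂ X} trunc t γ X` for `X ⊆ Λ` (the integrals *"as in (5.14.2)"* exist — `g₃` is
an arbitrary function of `t` here, so measurability is not derivable); in §6 the hypotheses of gen 5 verbatim (`R` symmetric of
degree `≤ Δ` via `nbr`, `0 < θ ≤ 1`, `0 ≤ β′`, `16(Δ+1)²θ^{β′/2}e² ≤ 1`, (5.14.4) on `[0,1]` with the covering guard).
READINGS (declared).  (a) MULTILINEARITY: p. 308 [PDF 52], verbatim: *"We express each d/dt as a sum Σ_γ (d/dt)_γ where (d/dt)_γ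
acts only on the t before a particular term F^{(k)}(Y) in Ṽ^{(k)} or in a particular χ-factor. We cluster expand as before each
integral making up the truncated expectation values ⟨(d/dt)_{γ_1}; …; (d/dt)_{γ_{n̄+1}}⟩_t."* — so the truncated expectation of the
`n̄+1` copies of `d/dt` in (5.14.2) is `Σ_γ ⟨(d/dt)_{γ_1};…;(d/dt)_{γ_{n̄+1}}⟩_t` over the assignments `γ` with supports in `Λ₁₂`
(multilinearity of truncated expectations): the integrand of `remR` is TAKEN to be `t ↦ Σ_{γ ∈ assignments Λ} κ_t(γ,H)`; (b) the region sum `Σ_{X⊂Λ₁₂}` is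
written over ALL `X ⊆ Λ` (`Λ.powerset`): the regions not filled by an admissible connected family — in particular `X = ∅` and the
`X` missing a derivative cube — contribute `trunc = 0` (§3; `BIJ88W6PrimeBound.term` vanishes without admissible families); (c) the
ordered re-indexing and the prime-dropped input are READINGS (a), (b) of file 2/3 and (iv) of gen 5 (there proved equivalent to the
printed partition form, `term_eq_sum_pterm`).  All statements are finite identities, identities of absolutely convergent real series,
or an exchange of a finite sum with an interval integral; 0 `sorry`, 0 new `Prop` facts, theorems only.
-/

open Finset MeasureTheory
open Literature.Probability.LatticeModels (setPartitions)
open Literature.MathematicalPhysics.QuantumFieldTheory.Dimock2011to13.UrsellTreeGraphBound (rhoT)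
open Literature.MathematicalPhysics.QuantumFieldTheory.BalabanImbrieJaffe1984to88.BIJ88Ineq5113Covering (polys mem_polys
  nonempty_of_mem_polys)
open Literature.MathematicalPhysics.QuantumFieldTheory.BalabanImbrieJaffe1984to88.BIJ88W6PrimeBound (fiber mem_fiber Adm term trunc
  assignments W6' mem_assignments wt partialSum_le abs_g3_le_rpow summable_abs_term)
open Literature.MathematicalPhysics.QuantumFieldTheory.BalabanImbrieJaffe1984to88.BIJ88ConnectedGraphResummation (OWP InQ Cov wprod
  Traw Tord Tsum Nsum Tord_zero display3 exists_carrier carrier_unique)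
open Literature.MathematicalPhysics.QuantumFieldTheory.BalabanImbrieJaffe1984to88.BIJ88Sect5StatementsPart4 (remR)

noncomputable section

namespace Literature.MathematicalPhysics.QuantumFieldTheory.BalabanImbrieJaffe1984to88.BIJ88RemainderW6Prime

variable {V : Type} [DecidableEq V] {T : Type}
variable {R : V → V → Prop} {nbar : ℕ} {Γ : Finset T} {loc : T → V}
  {g₃ : ℝ → (Fin (nbar + 1) → T) → Finset (Fin (nbar + 1)) → Finset V → ℝ}

/-! ## §1 The two bookkeepings agree: labellings `f : H → slots` (gen 5) ↔ ordered weak partitions `(f⁻¹(i))_i` (gen 6) -/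

section Link

/-- the fibres of a labelling form an ordered weak partition of the full slot set `H`. [cite: BalabanImbrieJaffe1988, p.310 (Sect. 5.14)] -/
theorem owp_fiber {m : ℕ} (f : Fin (nbar + 1) → Fin m) : OWP (univ : Finset (Fin (nbar + 1))) (fun i => fiber nbar f i) := by
  refine ⟨fun i i' hne => disjoint_left.2 fun j hj hj' => hne ((mem_fiber.1 hj).symm.trans (mem_fiber.1 hj')), ?_⟩
  ext j
  simp only [mem_biUnion, mem_univ, true_and, iff_true]
  exact ⟨f j, mem_fiber.2 rfl⟩

/-- an ordered weak partition of the full slot set is the fibre family of a labelling (the carrier map).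
[cite: BalabanImbrieJaffe1988, p.310 (Sect. 5.14)] -/
theorem exists_labelling {m : ℕ} {Hs : Fin m → Finset (Fin (nbar + 1))} (h : OWP (univ : Finset (Fin (nbar + 1))) Hs) :
    ∃ f : Fin (nbar + 1) → Fin m, (fun i => fiber nbar f i) = Hs := by
  choose f hf using fun j : Fin (nbar + 1) => exists_carrier h (mem_univ j)
  refine ⟨f, funext fun i => ?_⟩
  ext j
  rw [mem_fiber]
  exact ⟨fun hji => hji ▸ hf j, fun hj => carrier_unique h (hf j) hj⟩

variable (loc g₃)

/-- **The ordered bookkeepings of gen 5 (`BIJ88W6PrimeBound.term`: labellings `f`) and gen 6 (`Traw`: ordered weak partitions) agree**: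
for a fixed cluster tuple `Z`, `Σ_f [loc γ_j ∈ Z_{f j} ∀ j] c·Π_i g₃(f⁻¹(i), Z_i) = Σ_{(H_i)} [OWP H][cover] c·Π_i g₃(H_i, Z_i)`.
[cite: BalabanImbrieJaffe1988, p.310 (Sect. 5.14)] -/
theorem sum_labellings_eq_sum_owp (t : ℝ) (γ : Fin (nbar + 1) → T) {m : ℕ} (Z : Fin m → Finset V) (c : ℝ) :
    ∑ f : Fin (nbar + 1) → Fin m, (if ∀ j, loc (γ j) ∈ Z (f j) then c * ∏ i, g₃ t γ (fiber nbar f i) (Z i) else 0) =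
      ∑ Hs : Fin m → Finset (Fin (nbar + 1)),
        (if OWP (univ : Finset (Fin (nbar + 1))) Hs ∧ Cov (loc ∘ γ) Hs Z then c * wprod (g₃ t γ) Hs Z else 0) := by
  rw [← sum_filter, ← sum_filter]
  refine sum_bij (fun f _ => fun i => fiber nbar f i) (fun f hf => ?_) (fun f₁ _ f₂ _ h => ?_) (fun Hs hHs => ?_)
    (fun f _ => rfl)
  · obtain ⟨-, hcov⟩ := mem_filter.1 hf
    refine mem_filter.2 ⟨mem_univ _, owp_fiber f, fun i j hj => ?_⟩
    rw [Function.comp_apply, ← mem_fiber.1 hj]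
    exact hcov j
  · funext j
    have hj : j ∈ fiber nbar f₂ (f₁ j) := by
      rw [← show fiber nbar f₁ (f₁ j) = fiber nbar f₂ (f₁ j) from congrFun h (f₁ j)]
      exact mem_fiber.2 rfl
    exact (mem_fiber.1 hj).symm
  · obtain ⟨-, howp, hcov⟩ := mem_filter.1 hHs
    obtain ⟨f, hf⟩ := exists_labelling howp
    refine ⟨f, mem_filter.2 ⟨mem_univ _, fun j => ?_⟩, hf⟩
    have hjf : j ∈ Hs (f j) := by rw [← hf]; exact mem_fiber.2 rfl
    exact hcov (f j) j hjf

variable (R) {loc g₃}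

/-- the tuples of polymers of `Q` are the tuples satisfying `InQ Q`. [cite: BalabanImbrieJaffe1988, p.310 (Sect. 5.14)] -/
theorem piFinset_eq_filter_inQ [Fintype V] {m : ℕ} (Q : Finset (Finset V)) :
    Fintype.piFinset (fun _ : Fin m => Q) = univ.filter fun Z => InQ Q Z := by
  ext Z
  simp only [Fintype.mem_piFinset, mem_filter, mem_univ, true_and]
  rfl

/-- the tuples of polymers of `Λ` are the tuples of polymers of their union `X ⊆ Λ`, which they fill (*"summing only over {X_γ},
(Y₁,…,Y_B) which fill X"* ↔ the unrestricted families of display 3). [cite: BalabanImbrieJaffe1988, p.310 (Sect. 5.14)] -/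
theorem sum_tuples_eq_sum_fillings {m : ℕ} (Λ : Finset V) (G : (Fin m → Finset V) → ℝ) :
    ∑ Z ∈ Fintype.piFinset (fun _ : Fin m => polys R Λ), G Z =
      ∑ X ∈ Λ.powerset, ∑ Z ∈ Fintype.piFinset (fun _ : Fin m => polys R X), if univ.biUnion Z = X then G Z else 0 := by
  rw [← sum_fiberwise_of_maps_to (s := Fintype.piFinset (fun _ : Fin m => polys R Λ)) (t := Λ.powerset)
    (g := fun Z => univ.biUnion Z) fun Z hZ => ?_]
  · refine sum_congr rfl fun X hX => ?_
    rw [← sum_filter]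
    refine sum_congr ?_ fun _ _ => rfl
    ext Z
    simp only [mem_filter, Fintype.mem_piFinset, mem_polys]
    constructor
    · rintro ⟨hZ, hU⟩
      exact ⟨fun i => ⟨hU ▸ subset_biUnion_of_mem Z (mem_univ i), (hZ i).2⟩, hU⟩
    · rintro ⟨hZ, hU⟩
      exact ⟨fun i => ⟨(hZ i).1.trans (mem_powerset.1 hX), (hZ i).2⟩, hU⟩
  · rw [mem_powerset]
    exact biUnion_subset.2 fun i _ => (mem_polys.1 (Fintype.mem_piFinset.1 hZ i)).1

variable {R} (nbar loc g₃)

/-- admissibility = filling ∧ covering: the `f`-sum of `term` restricted by `Adm` is the covering sum when `Z` fills `X`, else `0`.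
[cite: BalabanImbrieJaffe1988, p.310 (Sect. 5.14)] -/
theorem sum_ite_adm (t : ℝ) (γ : Fin (nbar + 1) → T) (X : Finset V) {m : ℕ} (Z : Fin m → Finset V) :
    ∑ f : Fin (nbar + 1) → Fin m,
        (if Adm nbar loc γ X Z f then (rhoT Z univ : ℝ) * ∏ i, g₃ t γ (fiber nbar f i) (Z i) else 0) =
      if univ.biUnion Z = X then
        ∑ f : Fin (nbar + 1) → Fin m,
          (if ∀ j, loc (γ j) ∈ Z (f j) then (rhoT Z univ : ℝ) * ∏ i, g₃ t γ (fiber nbar f i) (Z i) else 0)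
      else 0 := by
  by_cases hU : univ.biUnion Z = X
  · rw [if_pos hU]
    refine sum_congr rfl fun f _ => ?_
    by_cases hc : ∀ j, loc (γ j) ∈ Z (f j)
    · rw [if_pos hc, if_pos (show Adm nbar loc γ X Z f from ⟨hU, hc⟩)]
    · rw [if_neg hc, if_neg fun h => hc h.2]
  · rw [if_neg hU]
    exact sum_eq_zero fun f _ => if_neg fun h => hU h.1

variable (R) [Fintype V]

/-- **LINK, degree-wise: the connected term of display 3 with `n+1` clusters, in the polymers of `Λ` with the activities
`g₃ᵗ(γ,·,·)`, is the sum over the filled regions `X ⊆ Λ` of gen 5's `term X n`** (`Tord (n+1) H = Σ_{X⊆Λ} term t γ X n`).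
[cite: BalabanImbrieJaffe1988, p.310 (Sect. 5.14)] -/
theorem Tord_succ_eq_sum_term (t : ℝ) (γ : Fin (nbar + 1) → T) (Λ : Finset V) (n : ℕ) :
    Tord (polys R Λ) (loc ∘ γ) (g₃ t γ) (n + 1) univ = ∑ X ∈ Λ.powerset, term R nbar loc g₃ t γ X n := by
  have key : Traw (polys R Λ) (loc ∘ γ) (g₃ t γ) (Fin (n + 1)) univ =
      ∑ X ∈ Λ.powerset, ∑ Z ∈ Fintype.piFinset (fun _ : Fin (n + 1) => polys R X),
        ∑ f : Fin (nbar + 1) → Fin (n + 1),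
          (if Adm nbar loc γ X Z f then (rhoT Z univ : ℝ) * ∏ i, g₃ t γ (fiber nbar f i) (Z i) else 0) := by
    symm
    calc ∑ X ∈ Λ.powerset, ∑ Z ∈ Fintype.piFinset (fun _ : Fin (n + 1) => polys R X),
          ∑ f : Fin (nbar + 1) → Fin (n + 1),
            (if Adm nbar loc γ X Z f then (rhoT Z univ : ℝ) * ∏ i, g₃ t γ (fiber nbar f i) (Z i) else 0)
        = ∑ X ∈ Λ.powerset, ∑ Z ∈ Fintype.piFinset (fun _ : Fin (n + 1) => polys R X),
            (if univ.biUnion Z = X then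
              ∑ f : Fin (nbar + 1) → Fin (n + 1),
                (if ∀ j, loc (γ j) ∈ Z (f j) then (rhoT Z univ : ℝ) * ∏ i, g₃ t γ (fiber nbar f i) (Z i) else 0)
             else 0) :=
          sum_congr rfl fun X _ => sum_congr rfl fun Z _ => sum_ite_adm nbar loc g₃ t γ X Z
      _ = ∑ Z ∈ Fintype.piFinset (fun _ : Fin (n + 1) => polys R Λ), ∑ f : Fin (nbar + 1) → Fin (n + 1),
            (if ∀ j, loc (γ j) ∈ Z (f j) then (rhoT Z univ : ℝ) * ∏ i, g₃ t γ (fiber nbar f i) (Z i) else 0) :=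
          (sum_tuples_eq_sum_fillings R Λ _).symm
      _ = ∑ Z : Fin (n + 1) → Finset V, if InQ (polys R Λ) Z then ∑ f : Fin (nbar + 1) → Fin (n + 1),
            (if ∀ j, loc (γ j) ∈ Z (f j) then (rhoT Z univ : ℝ) * ∏ i, g₃ t γ (fiber nbar f i) (Z i) else 0) else 0 := by
          rw [piFinset_eq_filter_inQ, sum_filter]
      _ = ∑ Z : Fin (n + 1) → Finset V, if InQ (polys R Λ) Z then ∑ Hs : Fin (n + 1) → Finset (Fin (nbar + 1)),
            (if OWP (univ : Finset (Fin (nbar + 1))) Hs ∧ Cov (loc ∘ γ) Hs Z then (rhoT Z univ : ℝ) * wprod (g₃ t γ) Hs Z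
             else 0) else 0 :=
          sum_congr rfl fun Z _ => by rw [sum_labellings_eq_sum_owp loc g₃ t γ Z]
      _ = ∑ Z : Fin (n + 1) → Finset V, ∑ Hs : Fin (n + 1) → Finset (Fin (nbar + 1)),
            (if OWP (univ : Finset (Fin (nbar + 1))) Hs ∧ InQ (polys R Λ) Z ∧ Cov (loc ∘ γ) Hs Z then
              (rhoT Z univ : ℝ) * wprod (g₃ t γ) Hs Z else 0) := by
          refine sum_congr rfl fun Z _ => ?_
          by_cases hQ : InQ (polys R Λ) Z
          · rw [if_pos hQ]
            refine sum_congr rfl fun Hs _ => ?_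
            by_cases h : OWP (univ : Finset (Fin (nbar + 1))) Hs ∧ Cov (loc ∘ γ) Hs Z
            · rw [if_pos h, if_pos ⟨h.1, hQ, h.2⟩]
            · rw [if_neg h, if_neg fun h' => h ⟨h'.1, h'.2.2⟩]
          · rw [if_neg hQ]
            exact (sum_eq_zero fun Hs _ => if_neg fun h => hQ h.2.1).symm
      _ = Traw (polys R Λ) (loc ∘ γ) (g₃ t γ) (Fin (n + 1)) univ := by
          unfold Traw
          exact sum_comm
  unfold Tord term
  rw [key, ← mul_sum, div_eq_mul_one_div, mul_comm]

end Link

/-! ## §2 The series: `T(H) = Σ_{X ⊆ Λ} trunc t γ X` -/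

section Series

variable (R nbar loc g₃) [Fintype V]

/-- the connected series is the shifted series of gen 5's terms: `m = 0` contributes nothing (`H ≠ ∅`).
[cite: BalabanImbrieJaffe1988, p.310 (Sect. 5.14)] -/
theorem summable_Tord_univ (t : ℝ) (γ : Fin (nbar + 1) → T) (Λ : Finset V)
    (hs : ∀ X ⊆ Λ, Summable fun n => term R nbar loc g₃ t γ X n) :
    Summable fun n => Tord (polys R Λ) (loc ∘ γ) (g₃ t γ) (n + 1) univ := by
  have h1 : (fun n => Tord (polys R Λ) (loc ∘ γ) (g₃ t γ) (n + 1) univ) =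
      fun n => ∑ X ∈ Λ.powerset, term R nbar loc g₃ t γ X n := funext fun n => Tord_succ_eq_sum_term R nbar loc g₃ t γ Λ n
  rw [h1]
  exact summable_sum (f := fun X n => term R nbar loc g₃ t γ X n) (s := Λ.powerset) fun X hX => hs X (mem_powerset.1 hX)

/-- **LINK, summed: the connected-graph series `T(H)` of display 3 (polymers of `Λ`, activities `g₃ᵗ(γ,·,·)`) equals
`Σ_{X ⊆ Λ} trunc t γ X`** — gen 5's `trunc X` is exactly the part of the printed formula *"summing only over {X_γ}, (Y₁,…,Y_B)
which fill X"*. Hypothesis: the cluster series of each `X ⊆ Λ` converges (discharged under (5.14.4) by gen 5's `summable_abs_term`).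
[cite: BalabanImbrieJaffe1988, p.310 (Sect. 5.14)] -/
theorem Tsum_univ_eq_sum_trunc (t : ℝ) (γ : Fin (nbar + 1) → T) (Λ : Finset V)
    (hs : ∀ X ⊆ Λ, Summable fun n => term R nbar loc g₃ t γ X n) :
    Tsum (polys R Λ) (loc ∘ γ) (g₃ t γ) univ = ∑ X ∈ Λ.powerset, trunc R nbar loc g₃ t γ X := by
  have hs' := summable_Tord_univ R nbar loc g₃ t γ Λ hs
  unfold Tsum trunc
  rw [tsum_eq_zero_add' (f := fun m => Tord (polys R Λ) (loc ∘ γ) (g₃ t γ) m univ) hs', Tord_zero _ _ _ univ_nonempty,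
    zero_add]
  have h1 : ∀ n, Tord (polys R Λ) (loc ∘ γ) (g₃ t γ) (n + 1) univ = ∑ X ∈ Λ.powerset, term R nbar loc g₃ t γ X n :=
    fun n => Tord_succ_eq_sum_term R nbar loc g₃ t γ Λ n
  rw [tsum_congr h1]
  exact Summable.tsum_finsetSum (f := fun X n => term R nbar loc g₃ t γ X n) (s := Λ.powerset)
    fun X hX => hs X (mem_powerset.1 hX)

end Series

/-! ## §3 Localization of the assignments: `trunc t γ X = 0` unless every derivative cube lies in `X` -/

section Localization

variable (R nbar loc g₃)

/-- a term of `X` vanishes unless all derivative cubes `loc γ_j` lie in `X` (the clusters filling `X` must cover them).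
[cite: BalabanImbrieJaffe1988, p.310 (Sect. 5.14)] -/
theorem term_eq_zero_of_not_mem {t : ℝ} {γ : Fin (nbar + 1) → T} {X : Finset V} (h : ∃ j, loc (γ j) ∉ X) (n : ℕ) :
    term R nbar loc g₃ t γ X n = 0 := by
  obtain ⟨j, hj⟩ := h
  unfold term
  refine mul_eq_zero_of_right _ (sum_eq_zero fun Z hZ => sum_eq_zero fun f _ => if_neg fun hA => hj ?_)
  exact (mem_polys.1 (Fintype.mem_piFinset.1 hZ (f j))).1 (hA.2 j)

/-- hence `trunc t γ X = 0` unless all derivative cubes lie in `X` (*"summing over {γ_j} with suppt(d/dt)_{γ_j} ⊂ X"*).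
[cite: BalabanImbrieJaffe1988, p.310 (Sect. 5.14)] -/
theorem trunc_eq_zero_of_not_mem {t : ℝ} {γ : Fin (nbar + 1) → T} {X : Finset V} (h : ∃ j, loc (γ j) ∉ X) :
    trunc R nbar loc g₃ t γ X = 0 := by
  unfold trunc
  rw [tsum_congr (fun n => term_eq_zero_of_not_mem R nbar loc g₃ h n)]
  exact tsum_zero

variable (Γ)

/-- **the assignment sum localizes**: `Σ_{γ: supports in Λ} Σ_{X⊆Λ} trunc t γ X = Σ_{X⊆Λ} Σ_{γ: supports in X} trunc t γ X`.
[cite: BalabanImbrieJaffe1988, p.310 (Sect. 5.14)] -/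
theorem sum_assignments_swap (t : ℝ) (Λ : Finset V) :
    ∑ γ ∈ assignments nbar Γ loc Λ, ∑ X ∈ Λ.powerset, trunc R nbar loc g₃ t γ X =
      ∑ X ∈ Λ.powerset, ∑ γ ∈ assignments nbar Γ loc X, trunc R nbar loc g₃ t γ X := by
  rw [sum_comm]
  refine sum_congr rfl fun X hX => ?_
  have hXΛ := mem_powerset.1 hX
  symm
  refine sum_subset (fun γ hγ => ?_) (fun γ hγΛ hγX => ?_)
  · rw [mem_assignments] at hγ ⊢
    exact fun j => ⟨(hγ j).1, hXΛ (hγ j).2⟩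
  · exact trunc_eq_zero_of_not_mem R nbar loc g₃ (not_forall.1 fun hall =>
      hγX (mem_assignments.2 fun j => ⟨(mem_assignments.1 hγΛ j).1, hall j⟩))

end Localization

/-! ## §4 The remainder: `ℛ_k(Λ₁₂) = Σ_{X ⊂ Λ₁₂} W₆^{(k)′}(X)` -/

section Remainder

variable (R nbar Γ loc g₃)

/-- **`ℛ_k(Λ₁₂^{(k)}) = Σ_{X ⊂ Λ₁₂^{(k)}} W₆^{(k)′}(X)`** (p. 310, display 4), from the identification of the truncated expectation of
the `n̄+1` localized derivatives with the sum over regions of gen 5's `trunc`: if `κ_t(γ) = Σ_{X⊆Λ} trunc t γ X` on `[0,1]` for the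
assignments `γ` with supports in `Λ`, then r16's printed remainder `remR` of (5.14.2), taken of the multilinear expansion
`⟨d/dt;…;d/dt⟩_t = Σ_γ κ_t(γ)` (`d/dt = Σ_γ (d/dt)_γ`), equals `Σ_{X ⊆ Λ} W6' X`.  Hypothesis: the `t`-integrals of (5.14.2) exist
region by region. [cite: BalabanImbrieJaffe1988, p.310 (Sect. 5.14)] -/
theorem remR_eq_sum_W6' (Λ : Finset V) (κ : ℝ → (Fin (nbar + 1) → T) → ℝ)
    (hκ : ∀ t ∈ Set.uIcc (0 : ℝ) 1, ∀ γ ∈ assignments nbar Γ loc Λ, κ t γ = ∑ X ∈ Λ.powerset, trunc R nbar loc g₃ t γ X)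
    (hint : ∀ X ⊆ Λ, IntervalIntegrable (fun t => ∑ γ ∈ assignments nbar Γ loc X, trunc R nbar loc g₃ t γ X) volume 0 1) :
    remR (fun t => ∑ γ ∈ assignments nbar Γ loc Λ, κ t γ) nbar = ∑ X ∈ Λ.powerset, W6' R nbar Γ loc g₃ X := by
  unfold remR W6'
  rw [← intervalIntegral.integral_finsetSum]
  · refine intervalIntegral.integral_congr fun t ht => ?_
    simp only
    rw [sum_congr rfl fun γ hγ => hκ t ht γ hγ, sum_assignments_swap R nbar Γ loc g₃ t Λ, mul_sum]
  · intro X hX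
    exact (hint X (mem_powerset.1 hX)).continuousOn_mul (by fun_prop)

variable [Fintype V]

/-- **DISPLAYS 1–4 OF p. 310 TOGETHER**: polymers of `Λ`, activities `g₃ᵗ(γ,·,·)`, normalization `z_t = N(∅) ≠ 0`, the connected
series absolutely convergent, the cluster series of every region convergent, the `t`-integrals existing; if the truncated expectations
`κ_t(γ, K) = ⟨Π_{j∈K}[;(d/dt)_{γ_j}]⟩_t` satisfy display 2 against the normalized expectations `N(K)/z_t` for every nonempty `K ⊆ H`
(`t ∈ [0,1]`, `γ` with supports in `Λ`), then `ℛ_k = remR(t ↦ Σ_γ κ_t(γ, H)) = Σ_{X ⊆ Λ} W₆′(X)`.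
[cite: BalabanImbrieJaffe1988, p.310 (Sect. 5.14)] -/
theorem remR_eq_sum_W6'_of_display2 (Λ : Finset V) (κ : ℝ → (Fin (nbar + 1) → T) → Finset (Fin (nbar + 1)) → ℝ)
    (hz : ∀ t ∈ Set.uIcc (0 : ℝ) 1, ∀ γ ∈ assignments nbar Γ loc Λ, Nsum (polys R Λ) (loc ∘ γ) (g₃ t γ) ∅ ≠ 0)
    (hT : ∀ t ∈ Set.uIcc (0 : ℝ) 1, ∀ γ ∈ assignments nbar Γ loc Λ, ∀ b : Finset (Fin (nbar + 1)), b.Nonempty →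
      Summable fun m => ‖Tord (polys R Λ) (loc ∘ γ) (g₃ t γ) m b‖)
    (hs : ∀ t ∈ Set.uIcc (0 : ℝ) 1, ∀ γ ∈ assignments nbar Γ loc Λ, ∀ X ⊆ Λ, Summable fun n => term R nbar loc g₃ t γ X n)
    (hκ : ∀ t ∈ Set.uIcc (0 : ℝ) 1, ∀ γ ∈ assignments nbar Γ loc Λ, ∀ K : Finset (Fin (nbar + 1)), K.Nonempty →
      Nsum (polys R Λ) (loc ∘ γ) (g₃ t γ) K / Nsum (polys R Λ) (loc ∘ γ) (g₃ t γ) ∅ =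
        ∑ π ∈ setPartitions K, ∏ b ∈ π, κ t γ b)
    (hint : ∀ X ⊆ Λ, IntervalIntegrable (fun t => ∑ γ ∈ assignments nbar Γ loc X, trunc R nbar loc g₃ t γ X) volume 0 1) :
    remR (fun t => ∑ γ ∈ assignments nbar Γ loc Λ, κ t γ univ) nbar = ∑ X ∈ Λ.powerset, W6' R nbar Γ loc g₃ X := by
  refine remR_eq_sum_W6' R nbar Γ loc g₃ Λ (fun t γ => κ t γ univ) (fun t ht γ hγ => ?_) hint
  have hQ : (∅ : Finset V) ∉ polys R Λ := fun h => (nonempty_of_mem_polys h).ne_empty rfl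
  have h3 := display3 (polys R Λ) (loc ∘ γ) (g₃ t γ) univ univ_nonempty hQ (hz t ht γ hγ)
    (fun b _ hb => hT t ht γ hγ b hb) (κ t γ) (fun K _ hK => hκ t ht γ hγ K hK)
  show κ t γ univ = _
  rw [h3]
  exact Tsum_univ_eq_sum_trunc R nbar loc g₃ t γ Λ (hs t ht γ hγ)

end Remainder

/-! ## §5 *"a standard exercise"*: absolute convergence of the connected series of every sub-collection under (5.14.4) -/

section Convergence

variable {nbr : V → Finset V} {Δ : ℕ} {θ β' : ℝ}

variable (loc)

/-- counting the labelled structures on a sub-collection `b ⊆ H`: the ordered weak partitions `(H_i)_{i<m}` of `b` compatible with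
the covering `loc(H_i) ⊆ Z_i` number at most `Π_{j∈b} #{i : loc γ_j ∈ Z_i} ≤ (Σ_i|Z_i|)^{|b|} ≤ |b|!·e^{Σ_i|Z_i|}` (the carrier map
`H ↦ (j ↦ {i : j ∈ H_i})` is injective). [cite: BalabanImbrieJaffe1988, p.310 (Sect. 5.14)] -/
theorem card_owp_cov_le (γ : Fin (nbar + 1) → T) {m : ℕ} (Z : Fin m → Finset V) (b : Finset (Fin (nbar + 1))) :
    (((univ : Finset (Fin m → Finset (Fin (nbar + 1)))).filter fun Hs => OWP b Hs ∧ Cov (loc ∘ γ) Hs Z).card : ℝ) ≤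
      b.card.factorial * Real.exp (∑ i, ((Z i).card : ℝ)) := by
  classical
  set S : ℝ := ∑ i, ((Z i).card : ℝ) with hS
  have hS0 : 0 ≤ S := sum_nonneg fun _ _ => Nat.cast_nonneg _
  set A := (univ : Finset (Fin m → Finset (Fin (nbar + 1)))).filter fun Hs => OWP b Hs ∧ Cov (loc ∘ γ) Hs Z with hA
  -- the carrier map and its target
  set car : (Fin m → Finset (Fin (nbar + 1))) → Fin (nbar + 1) → Finset (Fin m) :=
    fun Hs j => univ.filter fun i => j ∈ Hs i with hcar
  set tgt : Fin (nbar + 1) → Finset (Finset (Fin m)) := fun j =>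
    if j ∈ b then (univ.filter fun i => loc (γ j) ∈ Z i).image (fun i => ({i} : Finset (Fin m))) else {∅} with htgt
  have hmaps : Set.MapsTo car A (Fintype.piFinset tgt) := by
    intro Hs hHs
    obtain ⟨-, howp, hcov⟩ := mem_filter.1 (mem_coe.1 hHs)
    refine mem_coe.2 (Fintype.mem_piFinset.2 fun j => ?_)
    by_cases hj : j ∈ b
    · obtain ⟨i, hi⟩ := exists_carrier howp hj
      have heq : car Hs j = {i} := by
        ext i'
        simp only [hcar, mem_filter, mem_univ, true_and, mem_singleton]
        exact ⟨fun h => carrier_unique howp h hi, fun h => h ▸ hi⟩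
      have ht : tgt j = (univ.filter fun i => loc (γ j) ∈ Z i).image (fun i => ({i} : Finset (Fin m))) := if_pos hj
      rw [ht, heq]
      exact mem_image.2 ⟨i, mem_filter.2 ⟨mem_univ _, hcov i j hi⟩, rfl⟩
    · have heq : car Hs j = ∅ := by
        refine filter_eq_empty_iff.2 fun i _ hji => hj ?_
        have : j ∈ univ.biUnion Hs := mem_biUnion.2 ⟨i, mem_univ _, hji⟩
        rwa [howp.2] at this
      have ht : tgt j = {∅} := if_neg hj
      rw [ht, heq]
      exact mem_singleton_self _
  have hinj : Set.InjOn car A := by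
    intro Hs₁ _ Hs₂ _ h
    funext i
    ext j
    have h1 : i ∈ car Hs₁ j ↔ i ∈ car Hs₂ j := by rw [h]
    simpa [hcar] using h1
  have hcard := card_le_card_of_injOn car hmaps hinj
  have htcard : ∀ j, ((tgt j).card : ℝ) ≤ if j ∈ b then S else 1 := by
    intro j
    by_cases hj : j ∈ b
    · have ht : tgt j = (univ.filter fun i => loc (γ j) ∈ Z i).image (fun i => ({i} : Finset (Fin m))) := if_pos hj
      rw [if_pos hj, ht, card_image_of_injective _ fun i i' h => singleton_injective h, hS, card_eq_sum_ones, Nat.cast_sum,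
        sum_filter]
      push_cast
      refine sum_le_sum fun i _ => ?_
      split_ifs with h
      · exact_mod_cast card_pos.2 ⟨_, h⟩
      · exact Nat.cast_nonneg _
    · have ht : tgt j = {∅} := if_neg hj
      rw [if_neg hj, ht, card_singleton, Nat.cast_one]
  calc (A.card : ℝ) ≤ ((Fintype.piFinset tgt).card : ℝ) := by exact_mod_cast hcard
    _ = ∏ j, ((tgt j).card : ℝ) := by rw [Fintype.card_piFinset, Nat.cast_prod]
    _ ≤ ∏ j, (if j ∈ b then S else 1) := prod_le_prod (fun _ _ => Nat.cast_nonneg _) fun j _ => htcard j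
    _ = S ^ b.card := by rw [Fintype.prod_ite_mem, prod_const]
    _ ≤ b.card.factorial * Real.exp S := by
        have h := Real.pow_div_factorial_le_exp _ hS0 b.card
        rwa [div_le_iff₀ (by positivity), mul_comm] at h

variable {loc} [Fintype V]

/-- steps (a)–(c) of the *"standard exercise"* on a sub-collection `b`: with (5.14.4) for the pairs `(H_i, Z_i)` at `(t, γ)`,
`|Traw_m(b)| ≤ θ^{(1−β′)|b|}·|b|!·Σ_{Z ∈ polys(Λ)^m} |ρ^T(Z)| Π_i w(Z_i)`, `w(Z) = θ^{(β′/2)|Z|}e^{|Z|}`.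
[cite: BalabanImbrieJaffe1988, p.310 (Sect. 5.14)] -/
theorem abs_Traw_le (hθ0 : 0 < θ) (hθ1 : θ ≤ 1) (hβ : 0 ≤ β') {t : ℝ} {γ : Fin (nbar + 1) → T}
    (h5144 : ∀ (K : Finset (Fin (nbar + 1))) (Y : Finset V), (∀ j ∈ K, loc (γ j) ∈ Y) →
      |g₃ t γ K Y| ≤ θ ^ ((K.card : ℝ) + β' * ((Y \ K.image fun j => loc (γ j)).card : ℝ)))
    (Λ : Finset V) (b : Finset (Fin (nbar + 1))) (m : ℕ) :
    |Traw (polys R Λ) (loc ∘ γ) (g₃ t γ) (Fin m) b| ≤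
      θ ^ ((1 - β') * b.card) * b.card.factorial *
        ∑ Z ∈ Fintype.piFinset (fun _ : Fin m => polys R Λ), |(rhoT Z univ : ℝ)| * ∏ i, wt (θ ^ (β' / 2)) (Z i) := by
  classical
  set σ : ℝ := θ ^ (β' / 2) with hσdef
  have hσ : 0 ≤ σ := Real.rpow_nonneg hθ0.le _
  set Cb : ℝ := θ ^ ((1 - β') * b.card) with hCb
  have hCb0 : 0 ≤ Cb := Real.rpow_nonneg hθ0.le _
  have hS0 : ∀ Z : Fin m → Finset V, 0 ≤ ∑ i, ((Z i).card : ℝ) := fun Z => sum_nonneg fun _ _ => Nat.cast_nonneg _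
  have hB0 : ∀ Z : Fin m → Finset V, 0 ≤ Cb * (|(rhoT Z univ : ℝ)| * ∏ i, σ ^ (Z i).card) :=
    fun Z => mul_nonneg hCb0 (mul_nonneg (abs_nonneg _) (prod_nonneg fun i _ => pow_nonneg hσ _))
  -- (1) one labelled family
  have hfam : ∀ (Hs : Fin m → Finset (Fin (nbar + 1))) (Z : Fin m → Finset V),
      |(if OWP b Hs ∧ InQ (polys R Λ) Z ∧ Cov (loc ∘ γ) Hs Z then (rhoT Z univ : ℝ) * wprod (g₃ t γ) Hs Z else 0)| ≤
        (if InQ (polys R Λ) Z then 1 else 0) * ((if OWP b Hs ∧ Cov (loc ∘ γ) Hs Z then 1 else 0) *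
          (Cb * (|(rhoT Z univ : ℝ)| * ∏ i, σ ^ (Z i).card))) := by
    intro Hs Z
    by_cases h : OWP b Hs ∧ InQ (polys R Λ) Z ∧ Cov (loc ∘ γ) Hs Z
    · obtain ⟨howp, hQ, hcov⟩ := h
      rw [if_pos ⟨howp, hQ, hcov⟩, if_pos hQ, if_pos ⟨howp, hcov⟩, one_mul, one_mul, abs_mul]
      have hbsum : ∑ i, ((Hs i).card : ℝ) = b.card := by
        rw [← howp.2, card_biUnion fun i _ i' _ hne => howp.1 i i' hne]
        push_cast
        rfl
      have hw : |wprod (g₃ t γ) Hs Z| ≤ Cb * ∏ i, σ ^ (Z i).card := by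
        unfold wprod
        rw [abs_prod]
        calc ∏ i, |g₃ t γ (Hs i) (Z i)| ≤ ∏ i, θ ^ ((1 - β') * (Hs i).card + β' * (Z i).card) :=
              prod_le_prod (fun i _ => abs_nonneg _) fun i _ => abs_g3_le_rpow hθ0 hθ1 hβ (h5144 _ _ (hcov i))
          _ = θ ^ ((1 - β') * b.card + β' * ∑ i, ((Z i).card : ℝ)) := by
              rw [← Real.rpow_sum_of_pos hθ0, sum_add_distrib, ← mul_sum, ← mul_sum, hbsum]
          _ ≤ θ ^ ((1 - β') * b.card + β' / 2 * ∑ i, ((Z i).card : ℝ)) :=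
              Real.rpow_le_rpow_of_exponent_ge hθ0 hθ1 (by nlinarith [hS0 Z])
          _ = Cb * ∏ i, σ ^ (Z i).card := by
              rw [Real.rpow_add hθ0, hCb, mul_sum, Real.rpow_sum_of_pos hθ0]
              congr 1
              exact prod_congr rfl fun i _ => by rw [hσdef, ← Real.rpow_natCast, ← Real.rpow_mul hθ0.le]
      calc |(rhoT Z univ : ℝ)| * |wprod (g₃ t γ) Hs Z| ≤ |(rhoT Z univ : ℝ)| * (Cb * ∏ i, σ ^ (Z i).card) :=
          mul_le_mul_of_nonneg_left hw (abs_nonneg _)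
        _ = Cb * (|(rhoT Z univ : ℝ)| * ∏ i, σ ^ (Z i).card) := by ring
    · rw [if_neg h, abs_zero]
      exact mul_nonneg (by split_ifs <;> norm_num) (mul_nonneg (by split_ifs <;> norm_num) (hB0 Z))
  -- (2)–(3) summing over the families, the multiplicity, and the tuples
  unfold Traw
  calc |∑ Hs : Fin m → Finset (Fin (nbar + 1)), ∑ Z : Fin m → Finset V,
          (if OWP b Hs ∧ InQ (polys R Λ) Z ∧ Cov (loc ∘ γ) Hs Z then (rhoT Z univ : ℝ) * wprod (g₃ t γ) Hs Z else 0)|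
      ≤ ∑ Hs : Fin m → Finset (Fin (nbar + 1)), |∑ Z : Fin m → Finset V,
          (if OWP b Hs ∧ InQ (polys R Λ) Z ∧ Cov (loc ∘ γ) Hs Z then (rhoT Z univ : ℝ) * wprod (g₃ t γ) Hs Z else 0)| :=
        abs_sum_le_sum_abs _ _
    _ ≤ ∑ Hs : Fin m → Finset (Fin (nbar + 1)), ∑ Z : Fin m → Finset V,
          |(if OWP b Hs ∧ InQ (polys R Λ) Z ∧ Cov (loc ∘ γ) Hs Z then (rhoT Z univ : ℝ) * wprod (g₃ t γ) Hs Z else 0)| :=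
        sum_le_sum fun Hs _ => abs_sum_le_sum_abs _ _
    _ = ∑ Z : Fin m → Finset V, ∑ Hs : Fin m → Finset (Fin (nbar + 1)),
          |(if OWP b Hs ∧ InQ (polys R Λ) Z ∧ Cov (loc ∘ γ) Hs Z then (rhoT Z univ : ℝ) * wprod (g₃ t γ) Hs Z else 0)| :=
        sum_comm
    _ ≤ ∑ Z : Fin m → Finset V, ∑ Hs : Fin m → Finset (Fin (nbar + 1)),
          (if InQ (polys R Λ) Z then 1 else 0) * ((if OWP b Hs ∧ Cov (loc ∘ γ) Hs Z then 1 else 0) *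
            (Cb * (|(rhoT Z univ : ℝ)| * ∏ i, σ ^ (Z i).card))) :=
        sum_le_sum fun Z _ => sum_le_sum fun Hs _ => hfam Hs Z
    _ = ∑ Z : Fin m → Finset V, (if InQ (polys R Λ) Z then 1 else 0) *
          ((((univ : Finset (Fin m → Finset (Fin (nbar + 1)))).filter
              fun Hs => OWP b Hs ∧ Cov (loc ∘ γ) Hs Z).card : ℝ) *
            (Cb * (|(rhoT Z univ : ℝ)| * ∏ i, σ ^ (Z i).card))) := by
        refine sum_congr rfl fun Z _ => ?_
        rw [← mul_sum, ← sum_mul, ← sum_filter, sum_const, nsmul_eq_mul, mul_one]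
    _ ≤ ∑ Z : Fin m → Finset V, (if InQ (polys R Λ) Z then 1 else 0) *
          ((b.card.factorial * Real.exp (∑ i, ((Z i).card : ℝ))) * (Cb * (|(rhoT Z univ : ℝ)| * ∏ i, σ ^ (Z i).card))) :=
        sum_le_sum fun Z _ => mul_le_mul_of_nonneg_left (mul_le_mul_of_nonneg_right (card_owp_cov_le loc γ Z b) (hB0 Z))
          (by split_ifs <;> norm_num)
    _ = ∑ Z ∈ Fintype.piFinset (fun _ : Fin m => polys R Λ),
          (b.card.factorial * Real.exp (∑ i, ((Z i).card : ℝ))) * (Cb * (|(rhoT Z univ : ℝ)| * ∏ i, σ ^ (Z i).card)) := by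
        rw [piFinset_eq_filter_inQ, sum_filter]
        refine sum_congr rfl fun Z _ => ?_
        split_ifs <;> simp
    _ = Cb * b.card.factorial *
          ∑ Z ∈ Fintype.piFinset (fun _ : Fin m => polys R Λ), |(rhoT Z univ : ℝ)| * ∏ i, wt σ (Z i) := by
        rw [mul_sum]
        refine sum_congr rfl fun Z _ => ?_
        simp only [wt]
        rw [prod_mul_distrib, ← Real.exp_sum]
        ring

/-- steps (a)–(d): the partial sums of `Σ_m |Tord_m(b)|` are at most `θ^{(1−β′)|b|}·|b|!·4θ^{β′/2}e²|Λ|` (Penrose's tree-graph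
inequality and the tuple summation: gen 5's `partialSum_le`, engine [Dimock2013] App. B). [cite: BalabanImbrieJaffe1988, p.310 (Sect. 5.14)] -/
theorem sum_abs_Tord_le (hR : ∀ x y, R x y → R y x) (hΔ : ∀ x, (nbr x).card ≤ Δ) (hnbr : ∀ x y, R x y → y ∈ nbr x)
    (hθ0 : 0 < θ) (hθ1 : θ ≤ 1) (hβ : 0 ≤ β')
    (hsmall : 16 * ((Δ : ℝ) + 1) ^ 2 * (θ ^ (β' / 2) * Real.exp 2) ≤ 1) {t : ℝ} {γ : Fin (nbar + 1) → T}
    (h5144 : ∀ (K : Finset (Fin (nbar + 1))) (Y : Finset V), (∀ j ∈ K, loc (γ j) ∈ Y) →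
      |g₃ t γ K Y| ≤ θ ^ ((K.card : ℝ) + β' * ((Y \ K.image fun j => loc (γ j)).card : ℝ)))
    (Λ : Finset V) {b : Finset (Fin (nbar + 1))} (hb : b.Nonempty) (N : ℕ) :
    ∑ m ∈ range N, |Tord (polys R Λ) (loc ∘ γ) (g₃ t γ) m b| ≤
      θ ^ ((1 - β') * b.card) * b.card.factorial * (2 * (2 * (θ ^ (β' / 2) * Real.exp 2)) * Λ.card) := by
  have hC0 : 0 ≤ θ ^ ((1 - β') * b.card) * (b.card.factorial : ℝ) := mul_nonneg (Real.rpow_nonneg hθ0.le _) (Nat.cast_nonneg _)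
  have hrhs : 0 ≤ θ ^ ((1 - β') * b.card) * b.card.factorial * (2 * (2 * (θ ^ (β' / 2) * Real.exp 2)) * Λ.card) :=
    mul_nonneg hC0 (by positivity)
  cases N with
  | zero => simpa using hrhs
  | succ N =>
    rw [sum_range_succ', Tord_zero _ _ _ hb, abs_zero, add_zero]
    calc ∑ n ∈ range N, |Tord (polys R Λ) (loc ∘ γ) (g₃ t γ) (n + 1) b|
        = ∑ n ∈ range N, (1 / ((n + 1).factorial : ℝ)) * |Traw (polys R Λ) (loc ∘ γ) (g₃ t γ) (Fin (n + 1)) b| := by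
          refine sum_congr rfl fun n _ => ?_
          unfold Tord
          rw [abs_div, Nat.abs_cast, div_eq_mul_one_div, mul_comm]
      _ ≤ ∑ n ∈ range N, (1 / ((n + 1).factorial : ℝ)) * (θ ^ ((1 - β') * b.card) * b.card.factorial *
            ∑ Z ∈ Fintype.piFinset (fun _ : Fin (n + 1) => polys R Λ), |(rhoT Z univ : ℝ)| * ∏ i, wt (θ ^ (β' / 2)) (Z i)) :=
          sum_le_sum fun n _ => mul_le_mul_of_nonneg_left (abs_Traw_le hθ0 hθ1 hβ h5144 Λ b (n + 1)) (by positivity)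
      _ = θ ^ ((1 - β') * b.card) * b.card.factorial * ∑ n ∈ range N, ((1 / ((n + 1).factorial : ℝ)) *
            ∑ Z ∈ Fintype.piFinset (fun _ : Fin (n + 1) => polys R Λ), |(rhoT Z univ : ℝ)| * ∏ i, wt (θ ^ (β' / 2)) (Z i)) := by
          rw [mul_sum]
          exact sum_congr rfl fun n _ => by ring
      _ ≤ _ := mul_le_mul_of_nonneg_left (partialSum_le hR hΔ hnbr (Real.rpow_nonneg hθ0.le _) hsmall Λ N) hC0

/-- **the hypothesis of display 3 DISCHARGED under (5.14.4)**: in the smallness regime of gen 5 (`16(Δ+1)²θ^{β′/2}e² ≤ 1`), the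
connected series `Σ_m Tord_m(b)` of every nonempty sub-collection `b ⊆ H` converges absolutely. [cite: BalabanImbrieJaffe1988, p.310 (Sect. 5.14)] -/
theorem summable_norm_Tord (hR : ∀ x y, R x y → R y x) (hΔ : ∀ x, (nbr x).card ≤ Δ) (hnbr : ∀ x y, R x y → y ∈ nbr x)
    (hθ0 : 0 < θ) (hθ1 : θ ≤ 1) (hβ : 0 ≤ β')
    (hsmall : 16 * ((Δ : ℝ) + 1) ^ 2 * (θ ^ (β' / 2) * Real.exp 2) ≤ 1) {t : ℝ} {γ : Fin (nbar + 1) → T}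
    (h5144 : ∀ (K : Finset (Fin (nbar + 1))) (Y : Finset V), (∀ j ∈ K, loc (γ j) ∈ Y) →
      |g₃ t γ K Y| ≤ θ ^ ((K.card : ℝ) + β' * ((Y \ K.image fun j => loc (γ j)).card : ℝ)))
    (Λ : Finset V) {b : Finset (Fin (nbar + 1))} (hb : b.Nonempty) :
    Summable fun m => ‖Tord (polys R Λ) (loc ∘ γ) (g₃ t γ) m b‖ := by
  have h := summable_of_sum_range_le (fun _ => abs_nonneg _) (sum_abs_Tord_le hR hΔ hnbr hθ0 hθ1 hβ hsmall h5144 Λ hb)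
  simpa only [Real.norm_eq_abs] using h

end Convergence

/-! ## §6 The remainder formula in the regime (5.14.4) -/

section Printed

variable [Fintype V] {nbr : V → Finset V} {Δ : ℕ} {θ β' : ℝ}

variable (Γ)

/-- **`ℛ_k(Λ₁₂^{(k)}) = Σ_{X ⊂ Λ₁₂^{(k)}} W₆^{(k)′}(X)` in the regime (5.14.4)** (p. 310, displays 1–4 with the *"standard exercise"*
done): `R` symmetric of degree `≤ Δ`, `0 < θ ≤ 1`, `β′ ≥ 0`, `16(Δ+1)²θ^{β′/2}e² ≤ 1`, (5.14.4) on `[0,1]`; normalization `z_t ≠ 0`;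
the truncated expectations `κ_t(γ,K)` related to the normalized expectations by display 2 (their definition); the `t`-integrals of
(5.14.2) existing region by region. Then the remainder `remR` of (5.14.2) of `⟨d/dt;…;d/dt⟩_t = Σ_γ κ_t(γ,H)` equals `Σ_{X⊆Λ} W6' X` —
the formula gen 5 (`BIJ88W6PrimeBound`) took as its MODEL, here DERIVED; the bound `|W₆′(X)| ≤ e^{−c r(e_k)|X|}·(small)` is gen 5's
`ineqW6'_of_ineq5144`. [cite: BalabanImbrieJaffe1988, p.310 (Sect. 5.14)] -/
theorem remR_eq_sum_W6'_of_ineq5144 (hR : ∀ x y, R x y → R y x) (hΔ : ∀ x, (nbr x).card ≤ Δ)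
    (hnbr : ∀ x y, R x y → y ∈ nbr x) (hθ0 : 0 < θ) (hθ1 : θ ≤ 1) (hβ : 0 ≤ β')
    (hsmall : 16 * ((Δ : ℝ) + 1) ^ 2 * (θ ^ (β' / 2) * Real.exp 2) ≤ 1)
    (h5144 : ∀ t ∈ Set.Icc (0 : ℝ) 1, ∀ (γ : Fin (nbar + 1) → T) (K : Finset (Fin (nbar + 1))) (Y : Finset V),
      (∀ j ∈ K, loc (γ j) ∈ Y) → |g₃ t γ K Y| ≤ θ ^ ((K.card : ℝ) + β' * ((Y \ K.image fun j => loc (γ j)).card : ℝ)))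
    (Λ : Finset V) (κ : ℝ → (Fin (nbar + 1) → T) → Finset (Fin (nbar + 1)) → ℝ)
    (hz : ∀ t ∈ Set.Icc (0 : ℝ) 1, ∀ γ ∈ assignments nbar Γ loc Λ, Nsum (polys R Λ) (loc ∘ γ) (g₃ t γ) ∅ ≠ 0)
    (hκ : ∀ t ∈ Set.Icc (0 : ℝ) 1, ∀ γ ∈ assignments nbar Γ loc Λ, ∀ K : Finset (Fin (nbar + 1)), K.Nonempty →
      Nsum (polys R Λ) (loc ∘ γ) (g₃ t γ) K / Nsum (polys R Λ) (loc ∘ γ) (g₃ t γ) ∅ =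
        ∑ π ∈ setPartitions K, ∏ b ∈ π, κ t γ b)
    (hint : ∀ X ⊆ Λ, IntervalIntegrable (fun t => ∑ γ ∈ assignments nbar Γ loc X, trunc R nbar loc g₃ t γ X) volume 0 1) :
    remR (fun t => ∑ γ ∈ assignments nbar Γ loc Λ, κ t γ univ) nbar = ∑ X ∈ Λ.powerset, W6' R nbar Γ loc g₃ X := by
  have hI : Set.uIcc (0 : ℝ) 1 = Set.Icc 0 1 := Set.uIcc_of_le zero_le_one
  refine remR_eq_sum_W6'_of_display2 R nbar Γ loc g₃ Λ κ (fun t ht => hz t (hI ▸ ht)) (fun t ht γ _ b hb => ?_)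
    (fun t ht γ _ X _ => ?_) (fun t ht => hκ t (hI ▸ ht)) hint
  · exact summable_norm_Tord hR hΔ hnbr hθ0 hθ1 hβ hsmall (h5144 t (hI ▸ ht) γ) Λ hb
  · exact (summable_abs_term hR hΔ hnbr hθ0 hθ1 hβ hsmall h5144 (hI ▸ ht) γ X).of_abs

end Printed

end Literature.MathematicalPhysics.QuantumFieldTheory.BalabanImbrieJaffe1984to88.BIJ88RemainderW6Prime

end
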